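import Literature.AlgebraicGeometry.Resolution.KunzRegularityCriterion
import Literature.RingTheory.Flat.RegularFibreFlat
import Literature.RingTheory.Flat.ShortExact
import Mathlib.RingTheory.RingHom.Flat
import Mathlib.RingTheory.Ideal.Over

/-!
# ResolutionOfSingularities / WeightedInvariant — `WeightedThesis`, line `kunz-tower-exceptional-defect`:
# Kunz's theorem, direction "regular ⇒ Frobenius flat"

Support file for `stmt-ResolutionOfSingularities-0569` (stub `stub_kunzFlat` of the lead skeleton):
**the Frobenius endomorphism of a regular local ring of prime characteristic `p` is flat**
(E. Kunz, *Characterizations of regular local rings of characteristic `p`*, Amer. J. Math. 91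
(1969), Thm. 2.1, direction (1) ⇒ (2); The Stacks Project, Tag 0EC0; Matsumura, *Commutative
Algebra*, Thm. 107). This is the `⇒` half of the named fact
`Literature.AlgebraicGeometry.Resolution.Kunz1969`, PROVED here (the named fact is not used).

## Proof

Not Kunz's (completion + Cohen structure theorem + `k⟦X⟧` free over `k⟦X^p⟧`), but the slicing
argument of Matsumura, *Commutative Ring Theory*, Thm. 23.1, run directly for the Frobenius: we
prove, by induction on `d = dim A`, that for a regular local ring `A`, a ring `B`, a ring
isomorphism `e : A ≃+* B` and an algebra structure `φ : A → B` with `φ a = e (a ^ p)` ("Frobenius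
followed by an isomorphism" — this formulation keeps source and target apart, so that no second
algebra structure is ever put on `A` itself), `B` is flat over `A`
(`flat_of_algebraMap_eq_ringEquiv_pow`).

* `d = 0`: `A` is a field.
* `d > 0`: pick `x ∈ 𝔪 ∖ 𝔪²`, so `A/xA` is regular local of dimension `d - 1`
  (Matsumura Thm. 14.2, `IsRegularLocalRing.quotient_span_singleton`); put `y = e x`, so
  `φ x = y ^ p` is a non-zero-divisor of the domain `B`. By Matsumura Thm. 22.3 in the form
  `Literature.RingTheory.Flat.flat_of_flat_quotient_of_isSMulRegular` it suffices that
  `B/y^pB` is flat over `A/xA`. Now `B/y^pB ⊇ yB/y^pB ⊇ ⋯ ⊇ y^pB/y^pB = 0` has successive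
  quotients `y^jB/y^{j+1}B ≅ B/yB`, and `B/yB` with the induced algebra structure
  `A/xA → B/yB` is again "Frobenius followed by the isomorphism `A/xA ≃ B/yB` induced by `e`",
  hence flat over `A/xA` by induction; an extension of flat modules being flat
  (`flat_of_exact_of_flat_of_flat'`, Stacks Tag 00HM), `B/y^pB` is flat over `A/xA`
  (`flat_of_flat_quotient_of_pow_eq_zero`).

Taking `B = A = R`, `e = id`, `φ = frobenius R p` gives `stub_kunzFlat`.
-/

-- single-problem summit: the doubled namespace component `ResolutionOfSingularities` is forced
set_option linter.dupNamespace false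

namespace Summit.ResolutionOfSingularities.ResolutionOfSingularities.Theorems.WeightedThesis.KunzTower

open Literature.AlgebraicGeometry.Resolution IsLocalRing TensorProduct

universe u v₁ v₂ v₃

/-- **An extension of flat modules is flat** (The Stacks Project, Tag 00HM (1) with Tag 00HL):
if `0 → N′ —f→ N —g→ N″ → 0` is exact and `N′`, `N″` are flat, then `N` is flat. Diagram chase:
for `u : M₁ → M₂` injective and `z ∈ N ⊗ M₁` killed by `N ⊗ u`, its image in `N″ ⊗ M₁` is
killed by the injective `N″ ⊗ u`, so `z` comes from `w ∈ N′ ⊗ M₁`; then `(N′ ⊗ u) w` is killed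
by the injective `f ⊗ M₂` (Tag 00HL, `N″` flat), and `N′ ⊗ u` is injective. [folklore] -/
theorem flat_of_exact_of_flat_of_flat' {R : Type u} [CommRing R] {N' : Type v₁} {N : Type v₂}
    {N'' : Type v₃} [AddCommGroup N'] [Module R N'] [AddCommGroup N] [Module R N]
    [AddCommGroup N''] [Module R N''] {f : N' →ₗ[R] N} {g : N →ₗ[R] N''}
    [Module.Flat R N'] [Module.Flat R N''] (hfg : Function.Exact f g)
    (hf : Function.Injective f) (hg : Function.Surjective g) : Module.Flat R N := by
  rw [Module.Flat.iff_lTensor_preserves_injective_linearMap]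
  intro M₁ M₂ _ _ _ _ u hu
  refine (injective_iff_map_eq_zero _).mpr fun z hz => ?_
  have h1 : (g.rTensor M₁) z = 0 := by
    refine (injective_iff_map_eq_zero _).mp
      (Module.Flat.lTensor_preserves_injective_linearMap (M := N'') u hu) _ ?_
    rw [← LinearMap.comp_apply, LinearMap.lTensor_comp_rTensor,
      ← LinearMap.rTensor_comp_lTensor, LinearMap.comp_apply, hz, map_zero]
  obtain ⟨w, rfl⟩ := (rTensor_exact M₁ hfg hg z).mp h1
  have h2 : (f.rTensor M₂) ((u.lTensor N') w) = 0 := by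
    rw [← LinearMap.comp_apply, LinearMap.rTensor_comp_lTensor, ← LinearMap.lTensor_comp_rTensor,
      LinearMap.comp_apply, hz]
  have h3 : (u.lTensor N') w = 0 :=
    (injective_iff_map_eq_zero _).mp
      (Literature.RingTheory.Flat.rTensor_injective_of_exact_of_flat hfg hf hg M₂) _ h2
  have h4 : w = 0 :=
    (injective_iff_map_eq_zero _).mp
      (Module.Flat.lTensor_preserves_injective_linearMap (M := N') u hu) _ h3
  rw [h4, map_zero]

/-- **Flatness of `B'` from flatness of `B'/yB'` when `y` is nilpotent and "regular up to its
index of nilpotency".** Let `A' → B'` be an algebra, `y ∈ B'` with `y ^ p = 0` and such that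
`y ^ j c = y ^ (j+1) d` with `j < p` forces `c ∈ yB'` (as happens in `B' = B/y^pB` for a
non-zero-divisor `y` of `B`). If `B'/yB'` is flat over `A'` then so is `B'`: the quotients
`B'/y^jB'`, `j ≤ p`, are flat by induction on `j`, through the exact sequences
`0 → B'/yB' —·y^j→ B'/y^{j+1}B' → B'/y^jB' → 0` and `flat_of_exact_of_flat_of_flat'`, and
`B' = B'/y^pB'`. [folklore] -/
theorem flat_of_flat_quotient_of_pow_eq_zero {A' : Type u} [CommRing A'] {B' : Type v₁}
    [CommRing B'] [Algebra A' B'] (y : B') (p : ℕ) (hyp : y ^ p = 0)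
    (hreg : ∀ (j : ℕ) (c d : B'), j < p → y ^ j * c = y ^ (j + 1) * d → ∃ c', c = y * c')
    [Module.Flat A' (B' ⧸ Ideal.span {y})] : Module.Flat A' B' := by
  -- `B' / y^j B'` is flat over `A'` for `j ≤ p`
  have key : ∀ j, j ≤ p → Module.Flat A' (B' ⧸ Ideal.span {y ^ j}) := by
    intro j
    induction j with
    | zero =>
      intro _
      haveI : Subsingleton (B' ⧸ Ideal.span {y ^ 0}) :=
        Ideal.Quotient.subsingleton_iff.mpr (by rw [pow_zero, Ideal.span_singleton_one])
      infer_instance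
    | succ j ih =>
      intro hj
      haveI := ih (Nat.le_of_succ_le hj)
      have hjp : j < p := hj
      -- the maps of the exact sequence `0 → B'/yB' → B'/y^(j+1)B' → B'/y^jB' → 0`
      have hker : (Ideal.span {y} : Submodule B' B') ≤
          LinearMap.ker (y ^ j • Submodule.mkQ (Ideal.span {y ^ (j + 1)})) := by
        intro z hz
        obtain ⟨c, rfl⟩ := Ideal.mem_span_singleton'.mp hz
        rw [LinearMap.mem_ker, LinearMap.smul_apply, Submodule.mkQ_apply,
          ← Submodule.Quotient.mk_smul, Submodule.Quotient.mk_eq_zero, smul_eq_mul]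
        exact Ideal.mem_span_singleton'.mpr ⟨c, by ring⟩
      have hle : (Ideal.span {y ^ (j + 1)} : Submodule B' B') ≤
          LinearMap.ker (Submodule.mkQ (Ideal.span {y ^ j})) := by
        rw [Submodule.ker_mkQ]
        exact Ideal.span_singleton_le_span_singleton.mpr (pow_dvd_pow y (Nat.le_succ j))
      obtain ⟨f, hf⟩ : ∃ f : (B' ⧸ Ideal.span {y}) →ₗ[B'] (B' ⧸ Ideal.span {y ^ (j + 1)}),
          ∀ c : B', f (Submodule.Quotient.mk c) = Submodule.Quotient.mk (y ^ j * c) :=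
        ⟨Submodule.liftQ _ (y ^ j • Submodule.mkQ (Ideal.span {y ^ (j + 1)})) hker, fun c => by
          rw [Submodule.liftQ_apply, LinearMap.smul_apply, Submodule.mkQ_apply,
            ← Submodule.Quotient.mk_smul, smul_eq_mul]⟩
      obtain ⟨g, hg⟩ : ∃ g : (B' ⧸ Ideal.span {y ^ (j + 1)}) →ₗ[B'] (B' ⧸ Ideal.span {y ^ j}),
          ∀ c : B', g (Submodule.Quotient.mk c) = Submodule.Quotient.mk c :=
        ⟨Submodule.liftQ _ (Submodule.mkQ (Ideal.span {y ^ j})) hle, fun c => by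
          rw [Submodule.liftQ_apply, Submodule.mkQ_apply]⟩
      -- `f` is injective: this is where the regularity hypothesis enters
      have hfinj : Function.Injective f := by
        refine (injective_iff_map_eq_zero f).mpr fun z hz => ?_
        obtain ⟨c, rfl⟩ := Submodule.Quotient.mk_surjective _ z
        rw [hf, Submodule.Quotient.mk_eq_zero] at hz
        obtain ⟨d, hd⟩ := Ideal.mem_span_singleton'.mp hz
        obtain ⟨c', hc'⟩ := hreg j c d hjp (by rw [← hd]; ring)
        rw [Submodule.Quotient.mk_eq_zero, hc']
        exact Ideal.mem_span_singleton'.mpr ⟨c', by ring⟩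
      have hgsurj : Function.Surjective g := by
        intro z
        obtain ⟨c, rfl⟩ := Submodule.Quotient.mk_surjective _ z
        exact ⟨Submodule.Quotient.mk c, hg c⟩
      have hexact : Function.Exact f g := by
        intro z
        obtain ⟨c, rfl⟩ := Submodule.Quotient.mk_surjective _ z
        rw [hg, Submodule.Quotient.mk_eq_zero]
        constructor
        · intro hc
          obtain ⟨d, hd⟩ := Ideal.mem_span_singleton'.mp hc
          refine ⟨Submodule.Quotient.mk d, ?_⟩
          rw [hf, ← hd, mul_comm]
        · rintro ⟨w, hw⟩
          obtain ⟨d, rfl⟩ := Submodule.Quotient.mk_surjective _ w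
          rw [hf, Submodule.Quotient.eq] at hw
          have h1 : y ^ j * d ∈ Ideal.span {y ^ j} :=
            Ideal.mem_span_singleton'.mpr ⟨d, mul_comm _ _⟩
          have h2 : y ^ j * d - c ∈ Ideal.span {y ^ j} :=
            Ideal.span_singleton_le_span_singleton.mpr (pow_dvd_pow y (Nat.le_succ j)) hw
          simpa using Ideal.sub_mem _ h1 h2
      have hexact' : Function.Exact (f.restrictScalars A') (g.restrictScalars A') :=
        fun z => hexact z
      exact flat_of_exact_of_flat_of_flat' hexact' hfinj hgsurj
  -- `B' ≅ B' / y^p B'`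
  haveI := key p le_rfl
  have hbot : (Ideal.span {y ^ p} : Ideal B') = ⊥ := by rw [hyp, Ideal.span_singleton_eq_bot]
  exact Module.Flat.of_linearEquiv ((Submodule.quotEquivOfEqBot _ hbot).symm.restrictScalars A')

/-- **Kunz's theorem (regular ⇒ Frobenius flat), in the form "Frobenius followed by an
isomorphism", by Matsumura's slicing argument (Thm. 23.1).** Let `A` be a regular local ring of
dimension `n`, `B` a ring, `e : A ≃+* B` a ring isomorphism and `A → B` an algebra structure with
`algebraMap A B a = e (a ^ p)` (`p ≥ 1`). Then `B` is flat over `A`. Induction on `n`: for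
`n = 0`, `A` is a field; for `n > 0` slice by `x ∈ 𝔪 ∖ 𝔪²` (Matsumura Thm. 14.2 and Thm. 22.3:
`IsRegularLocalRing.quotient_span_singleton`, `flat_of_flat_quotient_of_isSMulRegular`), the
flatness of `B/y^pB` over `A/xA` (`y = e x`) coming from the induction hypothesis for
`A/xA → B/yB` through `flat_of_flat_quotient_of_pow_eq_zero`. [folklore] -/
theorem flat_of_algebraMap_eq_ringEquiv_pow (p : ℕ) (hp : p ≠ 0) (n : ℕ) :
    ∀ (A B : Type u) [CommRing A] [CommRing B] [IsRegularLocalRing A] [Algebra A B]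
      (e : A ≃+* B), (∀ a, algebraMap A B a = e (a ^ p)) → ringKrullDim A = n →
      Module.Flat A B := by
  induction n with
  | zero =>
    intro A B _ _ _ _ e he hdim
    have hA := (isRegularLocalRing_iff A).mp ‹_›
    rw [hdim] at hA
    have h0 : (maximalIdeal A).spanFinrank = 0 := by exact_mod_cast hA
    have hm : maximalIdeal A = ⊥ :=
      (Submodule.spanFinrank_eq_zero_iff_eq_bot (IsNoetherian.noetherian _)).mp h0
    letI := ((IsLocalRing.isField_iff_maximalIdeal_eq).mpr hm).toField
    infer_instance
  | succ n ih =>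
    intro A B _ _ _ _ e he hdim
    haveI : IsNoetherianRing B := isNoetherianRing_of_ringEquiv A e
    haveI : IsLocalRing B := e.isLocalRing
    haveI : IsDomain A := isDomain_of_isRegularLocalRing A
    haveI : IsDomain B := MulEquiv.isDomain A e.symm.toMulEquiv
    haveI : IsLocalHom (algebraMap A B) := ⟨fun a ha => by
      rw [he] at ha
      have h1 : IsUnit (a ^ p) := by simpa using ha.map e.symm
      exact (isUnit_pow_iff hp).mp h1⟩
    -- `x ∈ 𝔪 ∖ 𝔪²`; `A' = A/xA` is regular local of dimension `n`
    obtain ⟨x, hxm, hx2⟩ := IsRegularLocalRing.exists_not_mem_sq (R := A)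
      (by rw [hdim]; exact_mod_cast Nat.succ_ne_zero n)
    obtain ⟨hA', hdimA'⟩ := IsRegularLocalRing.quotient_span_singleton hxm hx2
    haveI := hA'
    set I : Ideal A := Ideal.span {x} with hI
    have hn' : ringKrullDim (A ⧸ I) = n := by
      obtain ⟨m, hm⟩ := exists_nat_cast_eq_ringKrullDim (R := A ⧸ I)
      rw [hm, hdim] at hdimA'
      have : m + 1 = n + 1 := by exact_mod_cast hdimA'
      rw [hm]
      exact_mod_cast (show m = n by omega)
    have hx0 : x ≠ 0 := by
      rintro rfl
      exact hx2 (Ideal.zero_mem _)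
    -- `y = e x`, `φ x = y ^ p` is `B`-regular
    obtain ⟨y, hy⟩ : ∃ y : B, y = e x := ⟨e x, rfl⟩
    have hy0 : y ≠ 0 := by
      rw [hy]
      exact e.map_ne_zero_iff.mpr hx0
    have hφx : algebraMap A B x = y ^ p := by rw [he, map_pow, hy]
    have hxreg : IsSMulRegular B (algebraMap A B x) := fun a b hab =>
      mul_left_cancel₀ (by rw [hφx]; exact pow_ne_zero _ hy0) hab
    -- `J = x B = y^p B`, `B' = B/J`
    set J : Ideal B := I.map (algebraMap A B) with hJ
    have hJspan : J = Ideal.span {y ^ p} := by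
      rw [hJ, hI, Ideal.map_span, Set.image_singleton, hφx]
    have hypJ : y ^ p ∈ J := hJspan ▸ Ideal.mem_span_singleton_self _
    -- `B'' = B'/yB' ≅ B/yB ≅ A/xA`, the isomorphism `e''` induced by `e`
    have hIJ : Ideal.span {y} = I.map (e : A →+* B) := by
      rw [hI, Ideal.map_span, Set.image_singleton, hy]
      rfl
    have hle : J ≤ Ideal.span {y} := by
      rw [hJspan]
      exact Ideal.span_singleton_le_span_singleton.mpr (dvd_pow_self y hp)
    have hK : (Ideal.span {y}).map (Ideal.Quotient.mk J) =
        Ideal.span {Ideal.Quotient.mk J y} := by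
      rw [Ideal.map_span, Set.image_singleton]
    let e'' : A ⧸ I ≃+* (B ⧸ J) ⧸ Ideal.span {Ideal.Quotient.mk J y} :=
      (Ideal.quotientEquiv I (Ideal.span {y}) e hIJ).trans
        ((DoubleQuot.quotQuotEquivQuotOfLE hle).symm.trans (Ideal.quotEquivOfEq hK))
    have he'' : ∀ a', algebraMap (A ⧸ I) ((B ⧸ J) ⧸ Ideal.span {Ideal.Quotient.mk J y}) a' =
        e'' (a' ^ p) := by
      intro a'
      obtain ⟨a, rfl⟩ := Ideal.Quotient.mk_surjective a'
      rw [← map_pow]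
      change Ideal.Quotient.mk (Ideal.span {Ideal.Quotient.mk J y})
          (Ideal.Quotient.mk J (algebraMap A B a)) =
        Ideal.Quotient.mk (Ideal.span {Ideal.Quotient.mk J y}) (Ideal.Quotient.mk J (e (a ^ p)))
      rw [he]
    haveI : Module.Flat (A ⧸ I) ((B ⧸ J) ⧸ Ideal.span {Ideal.Quotient.mk J y}) :=
      ih (A ⧸ I) _ e'' he'' hn'
    -- `B' = B/y^pB` is flat over `A' = A/xA`
    haveI : Module.Flat (A ⧸ I) (B ⧸ J) := by
      refine flat_of_flat_quotient_of_pow_eq_zero (Ideal.Quotient.mk J y) p ?_ ?_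
      · rw [← map_pow]
        exact Ideal.Quotient.eq_zero_iff_mem.mpr hypJ
      · intro j c d hj hcd
        obtain ⟨c₀, rfl⟩ := Ideal.Quotient.mk_surjective c
        obtain ⟨d₀, rfl⟩ := Ideal.Quotient.mk_surjective d
        rw [← map_pow, ← map_pow, ← map_mul, ← map_mul, Ideal.Quotient.eq, hJspan] at hcd
        obtain ⟨t, ht⟩ := Ideal.mem_span_singleton'.mp hcd
        obtain ⟨k, hk⟩ := Nat.exists_eq_add_of_lt hj
        rw [hk] at ht
        refine ⟨Ideal.Quotient.mk J (d₀ + y ^ k * t), ?_⟩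
        rw [← map_mul]
        congr 1
        refine mul_left_cancel₀ (pow_ne_zero j hy0) ?_
        linear_combination -ht
    exact Literature.RingTheory.Flat.flat_of_flat_quotient_of_isSMulRegular hxm hxreg

/-- **Kunz's theorem, direction "regular ⇒ flat"** (Kunz 1969, Thm. 2.1, (1) ⇒ (2); The Stacks
Project, Tag 0EC0; stub `stub_kunzFlat` of line `kunz-tower-exceptional-defect`): the Frobenius
endomorphism `a ↦ a ^ p` of a regular local ring of prime characteristic `p` is flat. This is
`flat_of_algebraMap_eq_ringEquiv_pow` with `B = A = R`, `e = id`, `φ = frobenius R p`; it is the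
`⇒` half of the named fact `Literature.AlgebraicGeometry.Resolution.Kunz1969`, proved
unconditionally. [folklore] -/
theorem stub_kunzFlat :
    ∀ (p : ℕ) [Fact p.Prime] (R : Type) [CommRing R] [CharP R p] [IsRegularLocalRing R],
      (frobenius R p).Flat := by
  intro p _ R _ _ _
  obtain ⟨n, hn⟩ := exists_nat_cast_eq_ringKrullDim (R := R)
  exact @flat_of_algebraMap_eq_ringEquiv_pow p (Fact.out : p.Prime).ne_zero n R R _ _ _
    (frobenius R p).toAlgebra (RingEquiv.refl R) (fun a => rfl) hn

end Summit.ResolutionOfSingularities.ResolutionOfSingularities.Theorems.WeightedThesis.KunzTower
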